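import Mathlib
import HarnessLib
import Literature.Probability.MarkovChains.QMatrix
import Literature.Probability.MarkovChains.HittingProbabilityMinimal

/-!
# Hitting probabilities of a continuous-time chain: minimal non-negative solution of `Σ_j q_ij h_j = 0` off `A` (Norris, Theorem 3.3.1)

HONEST FRAMING: exact (Metropolis-corrected) sampling algorithms for lattice gauge theory; figures
of merit are autocorrelation/cost numbers at stated couplings and volumes; no continuum-physics claim.

Source: J. R. Norris, *Markov Chains*, Cambridge University Press 1997 [Norris1997], §3.3
"Hitting times and absorption probabilities", Theorem 3.3.1 with its one-line proof (p. 112):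
"Apply Theorem 1.3.2 to the jump chain and rewrite (1.3) in terms of `Q`."  Everything is PROVED
(0 named facts).  Vocabulary: `IsQMatrix`, `exitRate Q i = q_i`, `jumpMatrix Q = Π` (`QMatrix.lean`);
`hittingProbability`, `IsHitSystemSolution`, `Norris1997_thm_1_3_2` (`HittingProbabilityMinimal.lean`).

"Since the hitting probabilities are those of the jump chain we can calculate them as in Section
1.3": the hitting probabilities of the minimal chain with generator `Q` ARE those of its jump matrix
`Π`, and we set `ctHittingProbability Q A := hittingProbability (jumpMatrix Q) A`.

* `IsQHitSystemSolution Q A x` — the system of Theorem 3.3.1: `x_i = 1` (`i ∈ A`),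
  `Σ_{j∈I} q_ij x_j = 0` (`i ∉ A`) [cite: Norris1997, §3.3 Thm 3.3.1];
* `isHitSystemSolution_jumpMatrix_iff` — "(1.3) rewritten in terms of `Q`": for a Q-matrix the
  jump-chain system (1.3) and the `Q`-system have the same solutions [cite: Norris1997, §3.3, proof
  of Thm 3.3.1];
* **THEOREM 3.3.1** `Norris1997_thm_3_3_1` — `h^A` is the minimal non-negative solution of the
  `Q`-system [cite: Norris1997, §3.3 Thm 3.3.1].

Context (cell pub-lqcd, venture LatticeQCDFlow): absorption probabilities of event-driven
(continuous-time) dynamics are read off the generator directly, without passing to the embedded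
chain by hand.
-/

namespace Literature.Probability.MarkovChains

open Finset

variable {I : Type*} [Fintype I] [DecidableEq I] {Q : I → I → ℝ} {A : Set I}
  [DecidablePred (· ∈ A)]

/-- The hitting probabilities `h_i^A = P_i(D^A < ∞) = P_i(H^A < ∞)` of the (minimal) chain with
generator `Q` are those of its jump chain `Π`. [cite: Norris1997, §3.3 (p. 111–112: "Since the
hitting probabilities are those of the jump chain we can calculate them as in Section 1.3")] -/
noncomputable def ctHittingProbability (Q : I → I → ℝ) (A : Set I) [DecidablePred (· ∈ A)]
    (i : I) : ℝ :=
  hittingProbability (jumpMatrix Q) A i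

/-- The system of Theorem 3.3.1: `x_i = 1` for `i ∈ A`, `Σ_{j∈I} q_ij x_j = 0` for `i ∉ A`.
[cite: Norris1997, §3.3 Thm 3.3.1] -/
def IsQHitSystemSolution (Q : I → I → ℝ) (A : Set I) (x : I → ℝ) : Prop :=
  (∀ i, i ∈ A → x i = 1) ∧ ∀ i, i ∉ A → ∑ j, Q i j * x j = 0

omit [DecidableEq I] in
/-- A row with `q_i = 0` vanishes identically (off-diagonal entries `≥ 0` summing to `q_i`).
[cite: Norris1997, §2.1 (p. 60, conditions (i)–(iii))] -/
theorem IsQMatrix.row_eq_zero_of_exitRate_eq_zero (hQ : IsQMatrix Q) {i : I}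
    (hi : exitRate Q i = 0) (j : I) : Q i j = 0 := by
  classical
  by_cases hji : j = i
  · subst hji
    have : -Q j j = 0 := hi
    linarith
  · -- `Σ_{k ≠ i} q_ik = q_i = 0` with non-negative terms
    have hsum : ∑ k ∈ univ.erase i, Q i k = 0 := by rw [← exitRate_eq_sum_erase hQ, hi]
    have hnn : ∀ k ∈ univ.erase i, 0 ≤ Q i k := fun k hk => hQ.1 i k (ne_of_mem_erase hk).symm
    exact (sum_eq_zero_iff_of_nonneg hnn).1 hsum j (mem_erase.2 ⟨hji, mem_univ j⟩)

/-- **"(1.3) rewritten in terms of `Q`":** for `i` with `q_i ≠ 0`, `x_i = Σ_j π_ij x_j` iff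
`Σ_j q_ij x_j = 0` (`π_ij = q_ij/q_i` for `j ≠ i`, `π_ii = 0`, `q_ii = −q_i`). [cite: Norris1997,
§3.3, proof of Thm 3.3.1] -/
theorem jumpMatrix_firstStep_iff_of_ne {i : I} (hi : exitRate Q i ≠ 0)
    (x : I → ℝ) : x i = ∑ j, jumpMatrix Q i j * x j ↔ ∑ j, Q i j * x j = 0 := by
  have hJ : ∀ j, jumpMatrix Q i j = if j = i then 0 else Q i j / exitRate Q i := fun j => by
    simp [jumpMatrix, hi]
  simp_rw [hJ]
  have h1 : ∑ j, (if j = i then 0 else Q i j / exitRate Q i) * x j =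
      (∑ j ∈ univ.erase i, Q i j * x j) / exitRate Q i := by
    rw [sum_div, ← Finset.sum_erase_add _ _ (mem_univ i), if_pos rfl, zero_mul, add_zero]
    exact sum_congr rfl fun j hj => by rw [if_neg (ne_of_mem_erase hj)]; ring
  have h2 : ∑ j, Q i j * x j = ∑ j ∈ univ.erase i, Q i j * x j - exitRate Q i * x i := by
    rw [← Finset.sum_erase_add _ _ (mem_univ i), exitRate]
    ring
  rw [h1, h2, eq_div_iff hi]
  constructor
  · intro h; linarith
  · intro h; linarith

/-- For `i` with `q_i = 0` both equations are vacuous (`π_ii = 1`, row `i` of `Q` is zero).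
[cite: Norris1997, §3.3, proof of Thm 3.3.1; §3.1 (jump matrix: `π_ii = 1` if `q_i = 0`)] -/
theorem jumpMatrix_firstStep_iff_of_eq (hQ : IsQMatrix Q) {i : I} (hi : exitRate Q i = 0)
    (x : I → ℝ) : x i = ∑ j, jumpMatrix Q i j * x j ↔ ∑ j, Q i j * x j = 0 := by
  have hJ : ∀ j, jumpMatrix Q i j = if j = i then 1 else 0 := fun j => by simp [jumpMatrix, hi]
  simp_rw [hJ, ite_mul, one_mul, zero_mul, sum_ite_eq' univ i, if_pos (mem_univ i),
    hQ.row_eq_zero_of_exitRate_eq_zero hi, zero_mul, sum_const_zero]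

omit [DecidablePred (· ∈ A)] in
/-- The jump-chain system (1.3) and the `Q`-system of Theorem 3.3.1 have the same solutions.
[cite: Norris1997, §3.3, proof of Thm 3.3.1 ("rewrite (1.3) in terms of `Q`")] -/
theorem isHitSystemSolution_jumpMatrix_iff (hQ : IsQMatrix Q) (x : I → ℝ) :
    IsHitSystemSolution (jumpMatrix Q) A x ↔ IsQHitSystemSolution Q A x := by
  refine and_congr Iff.rfl (forall_congr' fun i => forall_congr' fun _ => ?_)
  by_cases hi : exitRate Q i = 0
  · exact jumpMatrix_firstStep_iff_of_eq hQ hi x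
  · exact jumpMatrix_firstStep_iff_of_ne hi x

/-- `h^A` solves the `Q`-system. [cite: Norris1997, §3.3 Thm 3.3.1] -/
theorem ctHittingProbability_isQHitSystemSolution (hQ : IsQMatrix Q) :
    IsQHitSystemSolution Q A (ctHittingProbability Q A) :=
  (isHitSystemSolution_jumpMatrix_iff hQ _).1
    (hittingProbability_isHitSystemSolution (jumpMatrix_isRowStochastic hQ))

/-- `0 ≤ h_i^A ≤ 1`. [cite: Norris1997, §3.3 Thm 3.3.1] -/
theorem ctHittingProbability_mem_Icc (hQ : IsQMatrix Q) (i : I) :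
    ctHittingProbability Q A i ∈ Set.Icc (0 : ℝ) 1 :=
  ⟨hittingProbability_nonneg (jumpMatrix_isRowStochastic hQ) i,
    hittingProbability_le_one (jumpMatrix_isRowStochastic hQ) i⟩

/-- Minimality: every non-negative solution of the `Q`-system dominates `h^A`. [cite: Norris1997,
§3.3 Thm 3.3.1] -/
theorem IsQHitSystemSolution.ctHittingProbability_le (hQ : IsQMatrix Q) {x : I → ℝ}
    (hx : IsQHitSystemSolution Q A x) (hx0 : ∀ i, 0 ≤ x i) (i : I) :
    ctHittingProbability Q A i ≤ x i :=
  ((isHitSystemSolution_jumpMatrix_iff hQ x).2 hx).hittingProbability_le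
    (jumpMatrix_isRowStochastic hQ) hx0 i

/-- **THEOREM 3.3.1 (Norris).**  The vector of hitting probabilities `h^A = (h_i^A : i ∈ I)` of the
continuous-time chain with generator `Q` is the minimal non-negative solution to the system of
linear equations `h_i^A = 1` for `i ∈ A`, `Σ_{j∈I} q_ij h_j^A = 0` for `i ∉ A`. [cite: Norris1997,
§3.3 Thm 3.3.1] -/
theorem Norris1997_thm_3_3_1 (hQ : IsQMatrix Q) :
    (IsQHitSystemSolution Q A (ctHittingProbability Q A) ∧ ∀ i, 0 ≤ ctHittingProbability Q A i) ∧
      ∀ x : I → ℝ, IsQHitSystemSolution Q A x → (∀ i, 0 ≤ x i) →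
        ∀ i, ctHittingProbability Q A i ≤ x i :=
  ⟨⟨ctHittingProbability_isQHitSystemSolution hQ, fun i => (ctHittingProbability_mem_Icc hQ i).1⟩,
    fun _ hx hx0 => hx.ctHittingProbability_le hQ hx0⟩

end Literature.Probability.MarkovChains
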